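import Literature.NumberTheory.Rogawski1990.ArchBouazizWallSetRepresentation      -- ★ p851224 (LH3-p01 (g5)): brings ★ (S7a) `exists_clm_ambient_endoEmbArch_sub_eq_sum` ∕ model, ★ (S4a) `integral_pi_subtype_eq_single` pattern, ★ p850992
import Literature.NumberTheory.Rogawski1990.ArchBouazizStableFamilyJumpZeroProduct    -- ★ (LH10-p02 (g4)): `endoTorus_snd_eq_of_forall_apply_one`; brings ★ (T-CONGR) `endoBlockAt_eq_of_mem_iff`
import HarnessLib

/-!
# TOOLS FOR THE TWO-CHART WALL-SET REPRESENTATION: Fubini at ONE place in `update` form, integrability on a proper leaf, and the ambient reading of the SPLIT chart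
# `insert w₀ S` at the wall representative `ĉ'` (stage (JH-B) of `JH-SPEC.v1.md`; Shelstad 1979 §4 Lemma 4.3, Bouaziz 1994 §3.2 (I₃), Varadarajan 1989 §6.4)

Topic `NumberTheory/Rogawski1990`; namespace `Literature.NumberTheory.Rogawski1990`.  THEOREMS ONLY (no `def`, no instance, no axiom, no `sorry`).  Cell `pub/hodgecm-mathlib`,
crux H413 (`stmt-HodgeConjecture-24833`), line LH3 (closer stub `stub_N9`, DIRECT ROAD), letter L3′ forward half = the jump clause (J) `ArchBzJump jcH (stOrbFamH L νH fH)`, brick (JH-B)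
(LH3-plan (g4) deal 2026-09-02T11:48:06Z; binder of record LH3-p01 (g5), rulings (B3)(B4)).  Author LH10-p01 (g5).  Count-neutral.

WHAT.  The two-chart edition of ★ `exists_wallSet_representation(_normal)` (p851224 ∕ p851323) reads the pi-leaf integral of the ADJACENT split chart `insert w₀ S` through the SAME
curried integrand `g` built for the compact chart `S` at `P₀ = {w₀}`.  Three pieces of bookkeeping, kept out of the head file:
* §1 **`integral_pi_subtype_eq_single_of_iff`** — the product over a one-point index type `{w // p w}` (`p w ↔ w = w₀`, e.g. `p := (· ∈ {w₀})`, the `Finset`-singleton predicate that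
  ★ (S7a)'s `P₀`-indexed model uses) is the factor (Mathlib `measurePreserving_piUnique`; twin of ★ `integral_pi_subtype_eq_single`); **`integral_pi_eq_integral_integral_update`** — FUBINI AT ONE PLACE for an
  integrable `Ψ` against `⊗_w μ_w`: `∫ Ψ d(⊗μ) = ∫_{z' : Π_{¬ p w}} ∫_{z : X_{w₀}} Ψ(update (ext z') w₀ z) dμ_{w₀} d(⊗_{¬ p w} μ)` (Mathlib `measurePreserving_piEquivPiSubtypeProd`,
  `integral_prod_symm`; the dependent `if` of the splitting IS the `update`).
* §2 **`integrable_of_null_compl_of_forall_not_mem_eq_zero`** — a continuous function vanishing on `Z ∖ 𝒮` (`Z` a closed carrier of `μ`, `𝒮` compact, `μ` finite on compacta) is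
  `μ`-integrable: the split leaf `Λ'` is NOT a Haar measure on a group, so integrability of `z ↦ g(ĉ', u⁻¹ • ↑↑(z₁ γ' z₂ z₁⁻¹))` comes from the leaf's PROPERNESS clause and its carrier.
* §3 **`apply_symm_update_split_conj_eq_ambientModel`** — THE READING IDENTITY OF THE SPLIT CHART: for `fH = Θ ∘ ↑↑ι_∞`, the update maps `Λ_w` of ★ `exists_clm_ambient_endoEmbArch_sub_eq_sum`,
  `w₀ ∉ S`, outer leaves `z'` off `w₀` and a split-leaf point `z = (z₁, z₂) ∈ G_{w₀} × G_{w₀}`: the integrand of the chart `insert w₀ S` at `c'`,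
  `fH(eA⁻¹(w ↦ [w = w₀ ? z₁ γ'_{w₀}(c') z₂ z₁⁻¹ : z'_{w,1} γ'_w(c') z'_{w,2} z'_{w,1}⁻¹]), b(c'))`, IS the ambient model of ★ `contDiff_wallSetAmbientModel L S {w₀} m` at
  `(AB, (ĉ', fun _ => u(ĉ')⁻¹ • ↑↑(z₁ γ'_{w₀}(c') z₂ z₁⁻¹)))`, `ĉ' := update c' w₀ (c'_{w₀}2, c'_{w₀}1, c'_{w₀}2)` the wall representative (`u(ĉ') = e^{i(c'_{w₀}2 + mπ)}`): the `U(Φ₁)`-part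
  reads slot `1` only (★ `endoTorus_snd_eq_of_forall_apply_one`), the blocks off `w₀` do not read the label at `w₀` (★ `endoBlockAt_eq_of_mem_iff`), and the `w₀`-block of `ι_∞(γ_S(ĉ'))`
  is moved into `Λ_{w₀}` where the centre `u(ĉ')` cancels.
HONEST LABEL: HC_CM is proved only modulo the 7 printed citations (2 remaining: hLiu418 = stmt-HodgeConjecture-24832, h413 = stmt-HodgeConjecture-24833) until rung 0 closes; bookkeeping,
pays nothing by itself.

## References
* [Shelstad1979] D. Shelstad, *Characters and inner forms of a quasi-split group over ℝ*, Compositio Math. 39 (1979), §4 Lemma 4.3 p. 25, Prop. 4.5 p. 26.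
* [Bouaziz1994IntegralesOrbitales] A. Bouaziz, *Intégrales orbitales sur les algèbres de Lie réductives*, Invent. Math. 115 (1994), §3.2 (I₃) p. 580.
* [Varadarajan1989] V. S. Varadarajan, *An Introduction to Harmonic Analysis on Semisimple Lie Groups*, Cambridge Stud. Adv. Math. 16 (1989), §6.4 Lemma 21, Thm 23.
* [Rogawski1990] J. D. Rogawski, *Automorphic Representations of Unitary Groups in Three Variables*, Ann. of Math. Stud. 123 (1990), §4.8 p. 53; §8.2 p. 122.
* [Folland1995] G. B. Folland, *A Course in Abstract Harmonic Analysis* (1995), §2.6 (2.52).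
-/

set_option autoImplicit false

noncomputable section

open MeasureTheory Measure Filter Topology Set Function NumberField NumberField.InfinitePlace NumberField.mixedEmbedding Matrix Complex
open Literature.NumberTheory.Automorphic Literature.NumberTheory.Automorphic.UnitaryGroup Literature.NumberTheory.Automorphic.ArchCartan
open scoped ContDiff MatrixGroups Matrix Classical ENNReal NNReal
open scoped Matrix.Norms.Operator

namespace Literature.NumberTheory.Rogawski1990

/-! ## §1 One place out of a finite product: the one-point collapse and Fubini in `update` form -/

section OnePlace

variable {W : Type*} {X : W → Type*} [∀ w, MeasurableSpace (X w)] {E : Type*} [NormedAddCommGroup E] [NormedSpace ℝ E]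

/-- **ONE-POINT COLLAPSE** over a one-point index type `{w // p w}`, `p w ↔ w = w₀` (e.g. the `Finset` singleton `p := (· ∈ {w₀})`): `∫_{Π_{p} X_w} F(g ⟨w₀, _⟩) d(⊗ μ) = ∫_{X_{w₀}} F dμ_{w₀}`
(Mathlib `measurePreserving_piUnique`; twin of ★ `integral_pi_subtype_eq_single`; the given `Fintype` structure is the subsingleton one). [cite: Folland1995, §2.6 (2.52)] -/
theorem integral_pi_subtype_eq_single_of_iff [Fintype W] (p : W → Prop) [DecidablePred p] (w₀ : W) (hp : ∀ w, p w ↔ w = w₀) [iF : Fintype {w : W // p w}]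
    (μ : ∀ w, Measure (X w)) [∀ w, SigmaFinite (μ w)] (F : X w₀ → E) :
    (∫ g : ∀ w : {w : W // p w}, X w.1, F (g ⟨w₀, (hp w₀).2 rfl⟩) ∂(Measure.pi fun w : {w : W // p w} => μ w.1)) = ∫ h, F h ∂(μ w₀) := by
  letI inst : Unique {w : W // p w} := ⟨⟨⟨w₀, (hp w₀).2 rfl⟩⟩, fun x => Subtype.ext ((hp x.1).1 x.2)⟩
  have hF : iF = Subtype.fintype p := Subsingleton.elim _ _
  subst hF
  exact (measurePreserving_piUnique (fun w : {w : W // p w} => μ w.1)).integral_comp' (g := F)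

/-- **FUBINI AT ONE PLACE, `update` FORM**: for `p w ↔ w = w₀`, `Ψ` integrable against `⊗_w μ_w` and any filler `d`,
`∫ Ψ d(⊗μ) = ∫_{z' : Π_{¬ p w} X_w} ∫_{z : X_{w₀}} Ψ(update (w ↦ [p w ? d_w : z'_w]) w₀ z) dμ_{w₀}(z) d(⊗_{¬ p w} μ_w)(z')` (Mathlib `measurePreserving_piEquivPiSubtypeProd`,
`integral_prod_symm`, and the one-point collapse; any `Fintype` structures on the two index subtypes). [cite: Folland1995, §2.6 (2.52)] [cite: Varadarajan1989, §6.4 Lemma 21] -/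
theorem integral_pi_eq_integral_integral_update [Fintype W] (p : W → Prop) [DecidablePred p] (w₀ : W) (hp : ∀ w, p w ↔ w = w₀)
    [Fintype {w : W // p w}] [Fintype {w : W // ¬ p w}]
    (μ : ∀ w, Measure (X w)) [∀ w, SigmaFinite (μ w)] (d : ∀ w, X w)
    {Ψ : (∀ w, X w) → E} (hΨ : Integrable Ψ (Measure.pi μ)) :
    ∫ zz, Ψ zz ∂(Measure.pi μ) =
      ∫ z' : ∀ w : {w : W // ¬ p w}, X w.1,
        (∫ z : X w₀, Ψ (Function.update (fun w => if h : p w then d w else (z' ⟨w, h⟩ : X w)) w₀ z) ∂(μ w₀))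
        ∂(Measure.pi fun w : {w : W // ¬ p w} => μ w.1) := by
  -- the `Fintype` instances on the two index subtypes are those of Mathlib's lemma (subsingleton)
  have h1 : (‹Fintype {w : W // p w}›) = Subtype.fintype p := Subsingleton.elim _ _
  have h2 : (‹Fintype {w : W // ¬ p w}›) = Subtype.fintype (fun w => ¬ p w) := Subsingleton.elim _ _
  subst h1 h2
  let e := MeasurableEquiv.piEquivPiSubtypeProd X p
  have hmp := measurePreserving_piEquivPiSubtypeProd μ p
  have hmp' := hmp.symm e
  have hint' := (hmp'.integrable_comp_emb e.symm.measurableEmbedding).2 hΨ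
  rw [← hmp'.integral_comp' Ψ, integral_prod_symm (fun q => Ψ (e.symm q)) hint']
  refine integral_congr_ae (Eventually.of_forall fun z' => ?_)
  -- the dependent `if` of the splitting is the `update` at `w₀`
  have hpt : ∀ a : ∀ w : {w : W // p w}, X w.1,
      e.symm (a, z') = Function.update (fun w => if h : p w then d w else (z' ⟨w, h⟩ : X w)) w₀ (a ⟨w₀, (hp w₀).2 rfl⟩) := by
    intro a
    funext w
    have hw' : e.symm (a, z') w = if h : p w then a ⟨w, h⟩ else z' ⟨w, h⟩ := rfl
    rw [hw']
    by_cases h : w = w₀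
    · subst h
      rw [Function.update_self, dif_pos ((hp w).2 rfl)]
    · rw [Function.update_of_ne h, dif_neg (fun h' => h ((hp w).1 h')), dif_neg (fun h' => h ((hp w).1 h'))]
  show (∫ a, Ψ (e.symm (a, z')) ∂(Measure.pi fun w : {w : W // p w} => μ w.1)) = _
  simp only [hpt]
  exact integral_pi_subtype_eq_single_of_iff p w₀ hp μ fun z => Ψ (Function.update (fun w => if h : p w then d w else (z' ⟨w, h⟩ : X w)) w₀ z)

end OnePlace

/-! ## §2 Integrability on a proper leaf: continuous, vanishing on the carrier off a compact -/

section Leaf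

variable {X : Type*} [TopologicalSpace X] [MeasurableSpace X] [BorelSpace X] [T2Space X] {E : Type*} [NormedAddCommGroup E]

/-- **INTEGRABILITY ON A PROPER LEAF**: `μ` finite on compacta and carried by the closed `Z` (`μ Zᶜ = 0`), `F` continuous with `F = 0` on `Z ∖ 𝒮` for a compact `𝒮` ⇒ `F` is `μ`-integrable
(`μ = μ|_Z`, and on `Z` the integrand lives on `𝒮`). [cite: Varadarajan1989, §6.4 Lemma 21] [cite: Folland1995, §2.6 (2.52)] -/
theorem integrable_of_null_compl_of_forall_not_mem_eq_zero (μ : Measure X) [IsFiniteMeasureOnCompacts μ] {Z : Set X} (hZcl : IsClosed Z) (hZnull : μ Zᶜ = 0)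
    {F : X → E} (hF : Continuous F) {𝒮 : Set X} (h𝒮 : IsCompact 𝒮) (hvan : ∀ z ∈ Z, z ∉ 𝒮 → F z = 0) : Integrable F μ := by
  have hZ : IntegrableOn F Z μ :=
    (hF.continuousOn.integrableOn_compact h𝒮).of_forall_sdiff_eq_zero hZcl.measurableSet fun z hz => hvan z hz.1 hz.2
  have hrestr : μ.restrict Z = μ := Measure.restrict_eq_self_of_ae_mem (mem_ae_iff.2 hZnull)
  rw [IntegrableOn, hrestr] at hZ
  exact hZ

end Leaf

/-! ## §3 The ambient reading of the SPLIT chart `insert w₀ S` at the wall representative `ĉ'` -/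

section Split

local notation3 "Φ₂[" L "]" => (Matrix.of fun i j : Fin 2 => if i.val + j.val + 1 = 2 then (1 : L) else 0)
local notation3 "Φ₁[" L "]" => (Matrix.of fun i j : Fin 1 => if i.val + j.val + 1 = 1 then (1 : L) else 0)
local notation3 "𝔸[" L "]" => ↥(arch (↥(maximalRealSubfield L)) L (IsCMField.complexConj L) 2 Φ₂[L])
local notation3 "𝔹[" L "]" => ↥(arch (↥(maximalRealSubfield L)) L (IsCMField.complexConj L) 1 Φ₁[L])

variable (L : Type) [Field L] [NumberField L] [IsCMField L] (S : Finset {w : InfinitePlace L // IsComplex w}) {w₀ : {w : InfinitePlace L // IsComplex w}}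

omit [NumberField L] [IsCMField L] in
/-- **The wall representative keeps slot `1`**: `(update c' w₀ (c'_{w₀}2, c'_{w₀}1, c'_{w₀}2)) w 1 = c' w 1` for every `w`. [cite: Shelstad1979, §4 p. 25] -/
theorem wallRep_apply_one (c' : {w : InfinitePlace L // IsComplex w} → Fin 3 → ℝ) (w : {w : InfinitePlace L // IsComplex w}) :
    Function.update c' w₀ ![c' w₀ 2, c' w₀ 1, c' w₀ 2] w 1 = c' w 1 := by
  by_cases h : w = w₀
  · subst h
    rw [Function.update_self]
    rfl
  · rw [Function.update_of_ne h]

omit [NumberField L] [IsCMField L] in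
/-- **Off `w₀` the wall representative is `c'`.** [cite: Shelstad1979, §4 p. 25] -/
theorem wallRep_apply_of_ne (c' : {w : InfinitePlace L // IsComplex w} → Fin 3 → ℝ) {w : {w : InfinitePlace L // IsComplex w}} (h : w ≠ w₀) :
    Function.update c' w₀ ![c' w₀ 2, c' w₀ 1, c' w₀ 2] w = c' w := by
  rw [Function.update_of_ne h]

omit [NumberField L] [IsCMField L] in
/-- **The centre of the wall representative**: `((ĉ'_{w₀}0 + ĉ'_{w₀}2)/2 + mπ) = c'_{w₀}2 + mπ`. [cite: Varadarajan1989, §6.4 Lemma 21] -/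
theorem wallRep_centre (c' : {w : InfinitePlace L // IsComplex w} → Fin 3 → ℝ) (m : ℤ) :
    (Function.update c' w₀ ![c' w₀ 2, c' w₀ 1, c' w₀ 2] w₀ 0 + Function.update c' w₀ ![c' w₀ 2, c' w₀ 1, c' w₀ 2] w₀ 2) / 2 + m * Real.pi = c' w₀ 2 + m * Real.pi := by
  rw [Function.update_self]
  show (c' w₀ 2 + c' w₀ 2) / 2 + m * Real.pi = c' w₀ 2 + m * Real.pi
  ring

omit [NumberField L] [IsCMField L] in
/-- **Off `w₀` the blocks of the two charts agree at the wall representative**: `γ^{insert w₀ S}_w(c' w) = γ^S_w(ĉ' w)` for `w ≠ w₀` (the local chart reads the label only through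
`w ∈ S`, ★ `endoBlockAt_eq_of_mem_iff`). [cite: Rogawski1990, §8.2 p. 122] -/
theorem endoBlockAt_insert_eq_endoBlockAt_wallRep (c' : {w : InfinitePlace L // IsComplex w} → Fin 3 → ℝ) {w : {w : InfinitePlace L // IsComplex w}} (h : w ≠ w₀) :
    endoBlockAt L (insert w₀ S) w (c' w) = endoBlockAt L S w (Function.update c' w₀ ![c' w₀ 2, c' w₀ 1, c' w₀ 2] w) := by
  rw [wallRep_apply_of_ne L c' h, endoBlockAt_eq_of_mem_iff L w (S := insert w₀ S) (S' := S) (by simp [Finset.mem_insert, h])]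

/-- **THE READING IDENTITY OF THE SPLIT CHART AT THE WALL REPRESENTATIVE.**  For `fH = Θ ∘ ↑↑ι_∞`, `Λ_w` with the difference formula of ★ `exists_clm_ambient_endoEmbArch_sub_eq_sum`, `w₀ ∉ S`,
outer leaves `z'` off `w₀` with their matrix reading `AB`, a split-leaf point `z ∈ G_{w₀} × G_{w₀}` and any leaf family `U` with `U w₀ = z`, `U w = z'_w` off `w₀` (e.g. `update (ext z') w₀ z`),
every `c'` and every integer `m`: the integrand of the chart `insert w₀ S` at the leaf point `U` IS the ambient model of ★ `contDiff_wallSetAmbientModel L S {w₀} (fun _ => m)` at `(AB, (ĉ', fun _ => u(ĉ')⁻¹ • ↑↑(z₁ γ'_{w₀}(c') z₂ z₁⁻¹)))`,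
`ĉ' = update c' w₀ (c'_{w₀}2, c'_{w₀}1, c'_{w₀}2)`, `u(ĉ') = e^{i(c'_{w₀}2 + mπ)}`. [cite: Rogawski1990, §4.8 p. 53; §8.2 p. 122] [cite: Varadarajan1989, §6.4 Lemma 21]
[cite: Shelstad1979, §4 Lemma 4.3 (p. 25)] -/
theorem apply_symm_update_split_conj_eq_ambientModel (hw₀ : w₀ ∉ S) {fH : 𝔸[L] × 𝔹[L] → ℂ} {Θ : Matrix (Fin 3) (Fin 3) (mixedSpace L) → ℂ}
    (hΘf : ∀ k, fH k = Θ (((endoEmbArch L k).val : GL (Fin 3) (mixedSpace L)) : Matrix (Fin 3) (Fin 3) (mixedSpace L)))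
    (Λ : {w : InfinitePlace L // IsComplex w} → (Matrix (Fin 2) (Fin 2) ℂ →L[ℝ] Matrix (Fin 3) (Fin 3) (mixedSpace L)))
    (hΛ : ∀ (G Y : ∀ w : {w : InfinitePlace L // IsComplex w}, ↥(archLocal L 2 Φ₂[L] w)) (b : 𝔹[L]),
      (((endoEmbArch L ((archPiEquivCM 2 L Φ₂[L]).symm Y, b)).val : GL (Fin 3) (mixedSpace L)) : Matrix (Fin 3) (Fin 3) (mixedSpace L)) =
        (((endoEmbArch L ((archPiEquivCM 2 L Φ₂[L]).symm G, b)).val : GL (Fin 3) (mixedSpace L)) : Matrix (Fin 3) (Fin 3) (mixedSpace L)) +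
          ∑ w, Λ w ((((Y w : ↥(archLocal L 2 Φ₂[L] w)) : GL (Fin 2) ℂ) : Matrix (Fin 2) (Fin 2) ℂ) - (((G w : ↥(archLocal L 2 Φ₂[L] w)) : GL (Fin 2) ℂ) : Matrix (Fin 2) (Fin 2) ℂ)))
    (m : ℤ)
    (z' : ∀ w : {w : {w : InfinitePlace L // IsComplex w} // w ∉ ({w₀} : Finset {w : InfinitePlace L // IsComplex w})}, ↥(archLocal L 2 Φ₂[L] w.1) × ↥(archLocal L 2 Φ₂[L] w.1))
    (AB : {w : InfinitePlace L // IsComplex w} → Matrix (Fin 2) (Fin 2) ℂ × Matrix (Fin 2) (Fin 2) ℂ)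
    (hAB : ∀ (w) (hw : w ∉ ({w₀} : Finset {w : InfinitePlace L // IsComplex w})), AB w = (((((z' ⟨w, hw⟩).1 : ↥(archLocal L 2 Φ₂[L] w)) : GL (Fin 2) ℂ) : Matrix (Fin 2) (Fin 2) ℂ),
      ((((z' ⟨w, hw⟩).2 * ((z' ⟨w, hw⟩).1)⁻¹ : ↥(archLocal L 2 Φ₂[L] w)) : GL (Fin 2) ℂ) : Matrix (Fin 2) (Fin 2) ℂ)))
    (z : ↥(archLocal L 2 Φ₂[L] w₀) × ↥(archLocal L 2 Φ₂[L] w₀))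
    (U : ∀ w : {w : InfinitePlace L // IsComplex w}, ↥(archLocal L 2 Φ₂[L] w) × ↥(archLocal L 2 Φ₂[L] w)) (hU₀ : U w₀ = z)
    (hU : ∀ (w) (hw : w ∉ ({w₀} : Finset {w : InfinitePlace L // IsComplex w})), U w = z' ⟨w, hw⟩)
    (c' : {w : InfinitePlace L // IsComplex w} → Fin 3 → ℝ) :
    fH ((archPiEquivCM 2 L Φ₂[L]).symm (fun w => (U w).1 * (endoBlockAt L (insert w₀ S) w (c' w) * (U w).2) * (U w).1⁻¹), (endoTorus L (insert w₀ S) c').2) =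
      Θ ((((endoEmbArch L (endoTorus L S (Function.update c' w₀ ![c' w₀ 2, c' w₀ 1, c' w₀ 2]))).val : GL (Fin 3) (mixedSpace L)) : Matrix (Fin 3) (Fin 3) (mixedSpace L)) +
        ∑ i : ↥({w₀} : Finset {w : InfinitePlace L // IsComplex w}), Λ i.1
          ((((Circle.exp ((Function.update c' w₀ ![c' w₀ 2, c' w₀ 1, c' w₀ 2] i.1 0 + Function.update c' w₀ ![c' w₀ 2, c' w₀ 1, c' w₀ 2] i.1 2) / 2 + m * Real.pi) : Circle) : ℂ) •
              (fun _ : ↥({w₀} : Finset {w : InfinitePlace L // IsComplex w}) =>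
                ((Circle.exp (c' w₀ 2 + m * Real.pi) : ℂ))⁻¹ •
                  (((z.1 * (endoBlockAt L (insert w₀ S) w₀ (c' w₀) * z.2) * z.1⁻¹ : ↥(archLocal L 2 Φ₂[L] w₀)) : GL (Fin 2) ℂ) : Matrix (Fin 2) (Fin 2) ℂ)) i : Matrix (Fin 2) (Fin 2) ℂ) -
            ((endoBlock L S (Function.update c' w₀ ![c' w₀ 2, c' w₀ 1, c' w₀ 2]) i.1 : GL (Fin 2) ℂ) : Matrix (Fin 2) (Fin 2) ℂ)) +
        ∑ w ∈ Finset.univ.filter (fun w => w ∉ ({w₀} : Finset {w : InfinitePlace L // IsComplex w})),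
          Λ w ((AB w).1 * ((endoBlock L S (Function.update c' w₀ ![c' w₀ 2, c' w₀ 1, c' w₀ 2]) w : GL (Fin 2) ℂ) : Matrix (Fin 2) (Fin 2) ℂ) * (AB w).2 -
            ((endoBlock L S (Function.update c' w₀ ![c' w₀ 2, c' w₀ 1, c' w₀ 2]) w : GL (Fin 2) ℂ) : Matrix (Fin 2) (Fin 2) ℂ))) := by
  classical
  set ĉ : {w : InfinitePlace L // IsComplex w} → Fin 3 → ℝ := Function.update c' w₀ ![c' w₀ 2, c' w₀ 1, c' w₀ 2] with hĉ_def
  -- the `U(Φ₁)`-part reads slot `1` only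
  have hb : (endoTorus L (insert w₀ S) c').2 = (endoTorus L S ĉ).2 :=
    endoTorus_snd_eq_of_forall_apply_one L (insert w₀ S) S fun w => (wallRep_apply_one L c' w).symm
  -- the base family of the compact chart at `ĉ` is the torus point
  have hγ : (archPiEquivCM 2 L Φ₂[L]).symm (fun w => endoBlock L S ĉ w) = (endoTorus L S ĉ).1 := by
    rw [ContinuousMulEquiv.symm_apply_eq]
    funext w
    exact (archPiEquivCM_endoTorus_fst L S ĉ w).symm
  rw [hΘf, hb, hΛ (fun w => endoBlock L S ĉ w), hγ, Prod.mk.eta]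
  congr 1
  rw [add_assoc]
  congr 1
  rw [← Finset.sum_filter_add_sum_filter_not Finset.univ (fun w => w ∈ ({w₀} : Finset {w : InfinitePlace L // IsComplex w}))]
  congr 1
  · -- the wall place: the leaf point is `z`, the centre cancels
    rw [Finset.sum_subtype (Finset.univ.filter (fun w => w ∈ ({w₀} : Finset {w : InfinitePlace L // IsComplex w})))
      (p := fun w => w ∈ ({w₀} : Finset {w : InfinitePlace L // IsComplex w})) (fun w => by simp)]
    refine Finset.sum_congr rfl fun i _ => ?_
    obtain ⟨i, hi⟩ := i
    have hi' : i = w₀ := Finset.mem_singleton.1 hi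
    subst hi'
    congr 2
    rw [hU₀, wallRep_centre L c' m, smul_smul, mul_inv_cancel₀ (Circle.coe_ne_zero _), one_smul]
  · -- the other places: the leaf conjugate as a product of matrices, the blocks of the two charts agree
    refine Finset.sum_congr rfl fun w hw => ?_
    have hw' : w ∉ ({w₀} : Finset {w : InfinitePlace L // IsComplex w}) := (Finset.mem_filter.1 hw).2
    have hne : w ≠ w₀ := fun h => hw' (Finset.mem_singleton.2 h)
    rw [hU w hw', hAB w hw', endoBlockAt_insert_eq_endoBlockAt_wallRep L S c' hne, ← endoBlock_eq_endoBlockAt, ← hĉ_def]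
    simp only [Subgroup.coe_mul, Subgroup.coe_inv, Units.val_mul, Matrix.mul_assoc]

end Split

end Literature.NumberTheory.Rogawski1990

end
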